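import Literature.Analysis.FluidPDE.NSBoundedSuitableEnergy
import Literature.Analysis.FluidPDE.SuitableWeakSliced
import Literature.Analysis.FluidPDE.HeatDuhamelBack
import HarnessLib

/-!
# The energy class of a bounded Navier–Stokes solution up to the top, with the constant fixed
# before the solution

Analysis/FluidPDE proofs file (theorems only; no definitions, no named facts). First step of the
quantitative higher-regularity bootstrap for essentially bounded distributional solutions of the
Navier–Stokes system (Serrin 1962; Escauriaza–Seregin–Šverák 2003, §2; Seregin–Šverák 2009, §2
p. 6 and p. 8: "the pair `v` and `q`, satisfying conditions (b8)–(b10), is in fact a suitable weak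
solution … the corresponding norms are estimated by constants depending on … `‖v‖_{∞,Q₁}`"):

* `SerrinBootstrap.energy_bound_top_quant` — for `0 < r < R`, `M`, `P` there is `B` such that every
  distributional solution `(u, p)` (`ν = 1`, no force) on the centred cylinder
  `Q*_R((-R², 0)) = ]-2R², 0[ × B(0, R)` with `|u| ≤ M` a.e. and `∫∫ |p|^{3/2} ≤ P` has a weak
  spatial gradient `G = ∇u` on `Q*_R((-R², 0))` with `∫∫_{Q*_r((-r², 0))} |∇u|² ≤ B` — the bound
  holds **up to the top time `0`**, on `Q*_r((-r², 0)) = ]-2r², 0[ × B(0, r)`.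

This is the input `B` of the accepted quantitative vorticity bound
`SerrinTopQuant.spin_bound_top_quant` (`NSVorticityBoundedTopQuant.lean`), whose hypotheses are
exactly the conclusions here.

## Proof

Bounded solutions with `L^{3/2}` pressure are suitable on the whole (finite-measure) cylinder
(accepted `isSuitableWeakSolutionOn_of_bounded`), which supplies the weak gradient. The sliced
local energy inequality below a time level for cut-offs reaching over the top (accepted
`IsSuitableWeakSolutionOn.ae_localEnergy_slice_ennreal_of_forall_lt`) is applied to a product
cut-off `ζ = ζ₁(t) θ(x) ∈ [0, 1]`, `ζ = 1` on `[-2r², 1] × B(0, r)`, supported in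
`{t ≥ -R² - r²} × B̄(0, (r + R)/2)`, chosen before the solution: for a.e. `s < 0`,
`2 ∫∫_{t<s} |∇u|² ζ ≤ ∫∫_{t<s} R[ζ] ≤ (M²(K_t + K_Δ) + |M|³ K_∇)|Q| + 2|M| K_∇ (|Q| + P)`
(`|p| ≤ 1 + |p|^{3/2}`), and monotone convergence in `s ↑ 0`.

## References

* J. Serrin, Arch. Rational Mech. Anal. 9 (1962) 187–195, §2. [`Serrin1962`]
* G. Seregin, V. Šverák, Comm. PDE 34 (2009) = arXiv:0804.1803, §2 p. 6, p. 8.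
  [`SereginSverak2009`]
* F. Lin, Comm. Pure Appl. Math. 51 (1998), Def. 1 and (1.4) (sliced local energy inequality).
  [`Lin1998`]
-/

noncomputable section

open MeasureTheory Set Function Filter Topology TopologicalSpace Metric
open scoped NNReal ENNReal RealInnerProductSpace Laplacian

namespace Literature.Analysis.FluidPDE

namespace SerrinBootstrap

/-! ### A nonnegative product cut-off reaching over the top -/

/-- **A product cut-off reaching over the top, with values in `[0, 1]`.** For `a < a' < T` and
`0 < ρ' < ρ` there is a global test field `φ = ζ(t) θ(x)` on `ℝ × ℝ³`, `0 ≤ φ ≤ 1`, with `φ = 1`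
on `[a', T + 1] × B(x₀, ρ')`, whose support lies in `{t ≥ (a + a')/2} × B̄(x₀, (ρ' + ρ)/2)`
(product of Mathlib bump functions; the accepted `HeatDivForm.exists_top_cutoff` with the range
recorded). [folklore] -/
theorem exists_top_cutoff_nonneg {a a' T ρ ρ' : ℝ} (haa' : a < a') (ha'T : a' < T) (hρ' : 0 < ρ')
    (h : ρ' < ρ) (x₀ : EuclideanSpace ℝ (Fin 3)) :
    ∃ φ : ℝ → EuclideanSpace ℝ (Fin 3) → ℝ,
      IsSpaceTimeTestOn (⊤ : Opens (ℝ × EuclideanSpace ℝ (Fin 3))) φ ∧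
      (∀ q : ℝ × EuclideanSpace ℝ (Fin 3), q ∈ tsupport (uncurry φ) →
        (a + a') / 2 ≤ q.1 ∧ dist q.2 x₀ ≤ (ρ' + ρ) / 2) ∧
      (∀ q : ℝ × EuclideanSpace ℝ (Fin 3), q.1 ∈ Icc a' (T + 1) → q.2 ∈ ball x₀ ρ' →
        φ q.1 q.2 = 1) ∧
      (∀ t x, 0 ≤ φ t x) ∧ (∀ t x, φ t x ≤ 1) := by
  let ζ : ContDiffBump ((a' + (T + 1)) / 2 : ℝ) :=
    ⟨(T + 1 - a') / 2, (T + 1 - a') / 2 + (a' - a) / 2, by linarith, by linarith⟩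
  let θ : ContDiffBump x₀ := ⟨ρ', (ρ' + ρ) / 2, hρ', by linarith⟩
  have hζout : ζ.rOut = (T + 1 - a') / 2 + (a' - a) / 2 := rfl
  have hθout : θ.rOut = (ρ' + ρ) / 2 := rfl
  have hsub : Function.support (uncurry fun t x => ζ t * θ x) ⊆
      closedBall ((a' + (T + 1)) / 2) ζ.rOut ×ˢ closedBall x₀ θ.rOut := by
    intro q hq
    rw [Function.mem_support] at hq
    simp only [uncurry] at hq
    have h1 : ζ q.1 ≠ 0 := left_ne_zero_of_mul hq
    have h2 : θ q.2 ≠ 0 := right_ne_zero_of_mul hq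
    have h1' : q.1 ∈ Function.support (ζ : ℝ → ℝ) := h1
    have h2' : q.2 ∈ Function.support (θ : EuclideanSpace ℝ (Fin 3) → ℝ) := h2
    rw [ζ.support_eq] at h1'
    rw [θ.support_eq] at h2'
    exact ⟨ball_subset_closedBall h1', ball_subset_closedBall h2'⟩
  have htsupp : tsupport (uncurry fun t x => ζ t * θ x) ⊆
      closedBall ((a' + (T + 1)) / 2) ζ.rOut ×ˢ closedBall x₀ θ.rOut :=
    closure_minimal hsub ((isClosed_closedBall).prod isClosed_closedBall)
  refine ⟨fun t x => ζ t * θ x, ⟨?_, ?_, fun _ _ => trivial⟩, ?_, ?_, ?_, ?_⟩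
  · exact (ζ.contDiff.comp contDiff_fst).mul (θ.contDiff.comp contDiff_snd)
  · exact HasCompactSupport.intro' ((isCompact_closedBall _ ζ.rOut).prod
      (isCompact_closedBall x₀ θ.rOut)) ((isClosed_closedBall).prod isClosed_closedBall)
      fun q hq => by
        by_contra hne
        exact hq (hsub (Function.mem_support.2 hne))
  · intro q hq
    obtain ⟨h1, h2⟩ := htsupp hq
    rw [mem_closedBall, Real.dist_eq, hζout] at h1
    rw [mem_closedBall, hθout] at h2
    refine ⟨?_, h2⟩
    have := (abs_le.1 h1).1
    linarith
  · rintro ⟨t, x⟩ ht hx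
    simp only at ht hx
    have h1 : ζ t = 1 := ζ.one_of_mem_closedBall (by
      rw [mem_closedBall, Real.dist_eq]
      change |t - (a' + (T + 1)) / 2| ≤ (T + 1 - a') / 2
      rw [abs_le]
      constructor <;> linarith [ht.1, ht.2])
    have h2 : θ x = 1 := θ.one_of_mem_closedBall (by
      rw [mem_closedBall]
      exact (mem_ball.1 hx).le)
    simp [h1, h2]
  · exact fun t x => mul_nonneg (ζ.nonneg) (θ.nonneg)
  · intro t x
    exact mul_le_one₀ ζ.le_one θ.nonneg θ.le_one

/-! ### Elementary bounds -/

/-- `|p| ≤ 1 + |p|^{3/2}` for every real `p`. [folklore] -/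
theorem abs_le_one_add_abs_rpow_three_halves (p : ℝ) : |p| ≤ 1 + |p| ^ (3 / 2 : ℝ) := by
  rcases le_or_gt |p| 1 with h | h
  · have : 0 ≤ |p| ^ (3 / 2 : ℝ) := Real.rpow_nonneg (abs_nonneg p) _
    linarith
  · calc |p| = |p| ^ (1 : ℝ) := (Real.rpow_one _).symm
      _ ≤ |p| ^ (3 / 2 : ℝ) := Real.rpow_le_rpow_of_exponent_le h.le (by norm_num)
      _ ≤ 1 + |p| ^ (3 / 2 : ℝ) := le_add_of_nonneg_left zero_le_one

/-- The pointwise bound on the local energy integrand of a bounded field at a point where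
`‖u‖ ≤ M`: with `K_t ≥ |∂ₜζ|`, `K_Δ ≥ |Δζ|`, `K_∇ ≥ ‖∇ζ‖`,
`|R[ζ]| ≤ M²(K_t + K_Δ) + (M² + 2|p|)|M| K_∇`. [folklore] -/
theorem abs_localEnergyRHS_le {u : ℝ → EuclideanSpace ℝ (Fin 3) → EuclideanSpace ℝ (Fin 3)}
    {p : ℝ → EuclideanSpace ℝ (Fin 3) → ℝ} {ζ : ℝ → EuclideanSpace ℝ (Fin 3) → ℝ} {M Kt Kl Kg : ℝ}
    {z : ℝ × EuclideanSpace ℝ (Fin 3)} (hz : ‖u z.1 z.2‖ ≤ M)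
    (hKt : |timeDeriv ζ z.1 z.2| ≤ Kt) (hKl : |Δ (ζ z.1) z.2| ≤ Kl)
    (hKg : ‖gradient (ζ z.1) z.2‖ ≤ Kg) :
    |localEnergyRHS 1 0 u p ζ z| ≤
      M ^ 2 * (Kt + Kl) + (M ^ 2 + 2 * |p z.1 z.2|) * |M| * Kg := by
  have hM0 : 0 ≤ M := (norm_nonneg _).trans hz
  have hu2 : ‖u z.1 z.2‖ ^ 2 ≤ M ^ 2 := pow_le_pow_left₀ (norm_nonneg _) hz 2
  rw [localEnergyRHS_apply]
  simp only [Pi.zero_apply, inner_zero_left, mul_zero, zero_mul, add_zero, one_mul]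
  have h1 : |‖u z.1 z.2‖ ^ 2 * (timeDeriv ζ z.1 z.2 + Δ (ζ z.1) z.2)| ≤ M ^ 2 * (Kt + Kl) := by
    rw [abs_mul, abs_of_nonneg (by positivity : (0 : ℝ) ≤ ‖u z.1 z.2‖ ^ 2)]
    have : |timeDeriv ζ z.1 z.2 + Δ (ζ z.1) z.2| ≤ Kt + Kl :=
      (abs_add_le _ _).trans (add_le_add hKt hKl)
    exact mul_le_mul hu2 this (abs_nonneg _) (sq_nonneg M)
  have h2 : |(‖u z.1 z.2‖ ^ 2 + 2 * p z.1 z.2) * ⟪u z.1 z.2, gradient (ζ z.1) z.2⟫| ≤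
      (M ^ 2 + 2 * |p z.1 z.2|) * |M| * Kg := by
    rw [abs_mul]
    have ha : |‖u z.1 z.2‖ ^ 2 + 2 * p z.1 z.2| ≤ M ^ 2 + 2 * |p z.1 z.2| := by
      refine (abs_add_le _ _).trans (add_le_add ?_ (le_of_eq ?_))
      · rw [abs_of_nonneg (by positivity : (0 : ℝ) ≤ ‖u z.1 z.2‖ ^ 2)]; exact hu2
      · rw [abs_mul, abs_two]
    have hb : |⟪u z.1 z.2, gradient (ζ z.1) z.2⟫| ≤ |M| * Kg := by
      refine (abs_real_inner_le_norm _ _).trans ?_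
      rw [abs_of_nonneg hM0]
      exact mul_le_mul hz hKg (norm_nonneg _) hM0
    rw [mul_assoc]
    exact mul_le_mul ha hb (abs_nonneg _) (by positivity)
  exact (abs_add_le _ _).trans (add_le_add h1 h2)

/-! ### The energy bound up to the top -/

set_option maxHeartbeats 1600000 in
/-- **Bounded distributional solutions are in the energy class up to the top, with the bound on
`∫∫ |∇u|²` fixed before the solution** (Seregin–Šverák 2009, §2 p. 6: pairs with (b8)–(b10) are
suitable weak solutions; p. 8: the norms are estimated by the data; mechanism Serrin 1962, §2 /
Lin 1998, (1.4)). For `0 < r < R`, `M`, `P` there is `B` such that: whenever `(u, p)` solves the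
Navier–Stokes system (`ν = 1`, no force) in the sense of distributions in the centred cylinder
`Q*_R((-R², 0)) = ]-2R², 0[ × B(0, R)`, with `|u| ≤ M` a.e. there and `∫∫ |p|^{3/2} ≤ P`, then
`u` has a weak spatial gradient `G = ∇u` on `Q*_R((-R², 0))` with
`∫∫_{Q*_r((-r², 0))} |∇u|² ≤ B`, `Q*_r((-r², 0)) = ]-2r², 0[ × B(0, r)` (sharing the top time `0`).
[cite: SereginSverak2009, §2 p. 6 (suitability under (b8)–(b10)) and p. 8 (norms estimated by the data); Lin1998 (1.4)] -/
theorem energy_bound_top_quant {R r : ℝ} (hr0 : 0 < r) (hrR : r < R) (M : ℝ) (P : ℝ≥0) :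
    ∃ B : ℝ≥0, ∀ (u : ℝ → EuclideanSpace ℝ (Fin 3) → EuclideanSpace ℝ (Fin 3))
      (p : ℝ → EuclideanSpace ℝ (Fin 3) → ℝ),
      IsDistributionalNSSolutionOn
        (parabolicCylinderCenteredOpens R ((-R ^ 2 : ℝ), (0 : EuclideanSpace ℝ (Fin 3)))) 1 0 u p →
      (∀ᵐ w ∂(volume.restrict
        (parabolicCylinderCentered R ((-R ^ 2 : ℝ), (0 : EuclideanSpace ℝ (Fin 3))))), ‖u w.1 w.2‖ ≤ M) →
      (∫⁻ w in parabolicCylinderCentered R ((-R ^ 2 : ℝ), (0 : EuclideanSpace ℝ (Fin 3))),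
          ‖p w.1 w.2‖ₑ ^ (3 / 2 : ℝ) ≤ P) →
      ∃ G : ℝ → EuclideanSpace ℝ (Fin 3) → EuclideanSpace ℝ (Fin 3) →L[ℝ] EuclideanSpace ℝ (Fin 3),
        HasWeakSpatialGradientOn
          (parabolicCylinderCenteredOpens R ((-R ^ 2 : ℝ), (0 : EuclideanSpace ℝ (Fin 3)))) u G ∧
        ∫⁻ w in parabolicCylinderCentered r ((-r ^ 2 : ℝ), (0 : EuclideanSpace ℝ (Fin 3))),
            ENNReal.ofReal (frobeniusNormSq (G w.1 w.2)) ≤ B := by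
  have hR0 : 0 < R := hr0.trans hrR
  set z₀ : ℝ × EuclideanSpace ℝ (Fin 3) := ((-R ^ 2 : ℝ), (0 : EuclideanSpace ℝ (Fin 3))) with hz₀
  set Qs : Set (ℝ × EuclideanSpace ℝ (Fin 3)) := parabolicCylinderCentered R z₀ with hQs
  have hQs_eq : Qs = Ioo (-(2 * R ^ 2)) 0 ×ˢ ball (0 : EuclideanSpace ℝ (Fin 3)) R := by
    show Ioo (-R ^ 2 - R ^ 2) (-R ^ 2 + R ^ 2) ×ˢ ball (0 : EuclideanSpace ℝ (Fin 3)) R = _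
    rw [show -R ^ 2 - R ^ 2 = -(2 * R ^ 2) by ring, show -R ^ 2 + R ^ 2 = (0 : ℝ) by ring]
  have hQmeas : MeasurableSet Qs := by
    rw [hQs_eq]; exact measurableSet_Ioo.prod measurableSet_ball
  have hvolQ : volume Qs < ∞ := by
    rw [hQs_eq, Measure.volume_eq_prod, Measure.prod_prod]
    refine ENNReal.mul_lt_top ?_ measure_ball_lt_top
    rw [Real.volume_Ioo]
    exact ENNReal.ofReal_lt_top
  -- the cut-off, fixed before the solution
  have hsq : r ^ 2 < R ^ 2 := by nlinarith
  obtain ⟨ζ, hζ, hζsupp, hζ1, hζ0, hζle⟩ := exists_top_cutoff_nonneg (a := -(2 * R ^ 2))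
    (a' := -(2 * r ^ 2)) (T := 0) (by linarith) (by nlinarith) hr0 hrR
    (0 : EuclideanSpace ℝ (Fin 3))
  obtain ⟨Kt, hKt0, hKt⟩ := hζ.timeDeriv_top.exists_norm_le
  obtain ⟨Kl, hKl0, hKl⟩ := hζ.laplacian_top.exists_norm_le
  obtain ⟨Kg, hKg0, hKg⟩ := hζ.fderiv_top.exists_norm_le
  -- the constant
  set V : ℝ := (volume Qs).toReal with hV
  have hV0 : 0 ≤ V := ENNReal.toReal_nonneg
  set I : ℝ := (M ^ 2 * (Kt + Kl) + M ^ 2 * |M| * Kg) * V + 2 * |M| * Kg * (V + P) with hI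
  have hI0 : 0 ≤ I := by rw [hI]; positivity
  refine ⟨I.toNNReal, fun u p hsol hbd hp => ?_⟩
  -- suitability on the whole cylinder
  have hpfin : ∫⁻ w in Qs, ‖p w.1 w.2‖ₑ ^ (3 / 2 : ℝ) < ∞ := lt_of_le_of_lt hp ENNReal.coe_lt_top
  have hs : IsSuitableWeakSolutionOn (parabolicCylinderCenteredOpens R z₀) 1 0 u p :=
    isSuitableWeakSolutionOn_of_bounded one_pos hsol hvolQ hbd hpfin
  obtain ⟨G, hG, -, -⟩ := hs.localEnergy
  refine ⟨G, hG, ?_⟩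
  -- local integrability of `|u|³` (bounded) and of `f · u = 0`
  have hum : AEStronglyMeasurable (uncurry u) (volume.restrict Qs) := hsol.1.aestronglyMeasurable
  have hu3 : LocallyIntegrableOn (fun z : ℝ × EuclideanSpace ℝ (Fin 3) => ‖u z.1 z.2‖ ^ 3) Qs volume := by
    haveI : IsFiniteMeasure (volume.restrict Qs) := ⟨by rwa [Measure.restrict_apply_univ]⟩
    have hm : AEStronglyMeasurable (fun z : ℝ × EuclideanSpace ℝ (Fin 3) => ‖u z.1 z.2‖ ^ 3)
        (volume.restrict Qs) := (hum.norm.pow 3)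
    have hb : ∀ᵐ z ∂(volume.restrict Qs), ‖(fun z : ℝ × EuclideanSpace ℝ (Fin 3) => ‖u z.1 z.2‖ ^ 3) z‖ ≤ |M| ^ 3 := by
      filter_upwards [hbd] with z hz
      rw [Real.norm_eq_abs, abs_pow, abs_norm]
      exact pow_le_pow_left₀ (norm_nonneg _) (hz.trans (le_abs_self M)) 3
    have hint : IntegrableOn (fun z : ℝ × EuclideanSpace ℝ (Fin 3) => ‖u z.1 z.2‖ ^ 3) Qs volume :=
      (memLp_top_of_bound hm (|M| ^ 3) hb).integrable le_top
    exact hint.locallyIntegrableOn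
  have hfu : LocallyIntegrableOn
      (fun z : ℝ × EuclideanSpace ℝ (Fin 3) => ⟪(0 : ℝ → EuclideanSpace ℝ (Fin 3) → EuclideanSpace ℝ (Fin 3)) z.1 z.2, u z.1 z.2⟫)
      Qs volume := by
    simp only [Pi.zero_apply, inner_zero_left]
    exact locallyIntegrableOn_const _
  -- the support of `ζ` below every negative level lies in the cylinder
  have hζQ : ∀ τ < (0 : ℝ), tsupport (uncurry ζ) ∩ {z : ℝ × EuclideanSpace ℝ (Fin 3) | z.1 ≤ τ} ⊆ Qs := by
    intro τ hτ z hz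
    obtain ⟨h1, h2⟩ := hζsupp z hz.1
    have hz1 : z.1 ≤ τ := hz.2
    rw [hQs_eq]
    refine ⟨⟨?_, by linarith⟩, ?_⟩
    · have : -(2 * R ^ 2) < (-(2 * R ^ 2) + -(2 * r ^ 2)) / 2 := by nlinarith
      linarith
    · rw [mem_ball]
      have : (r + R) / 2 < R := by linarith
      exact lt_of_le_of_lt h2 this
  -- the sliced local energy inequality below the top
  have hslice := hs.ae_localEnergy_slice_ennreal_of_forall_lt hG hu3 hfu hζ hζ0 zero_le_one
    (T := 0) hζQ
  -- integrability of `p` on the cylinder and `∫ |p| ≤ V + P`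
  have hpm : AEStronglyMeasurable (uncurry p) (volume.restrict Qs) := hsol.2.2.1.aestronglyMeasurable
  have hp32 : MemLp (uncurry p) (ENNReal.ofReal (3 / 2)) (volume.restrict Qs) := by
    refine ⟨hpm, ?_⟩
    rw [eLpNorm_eq_lintegral_rpow_enorm_toReal (by simp) (by simp)]
    rw [ENNReal.toReal_ofReal (by norm_num : (0 : ℝ) ≤ 3 / 2)]
    refine ENNReal.rpow_lt_top_of_nonneg (by positivity) (lt_top_iff_ne_top.1 ?_)
    exact hpfin
  haveI : IsFiniteMeasure (volume.restrict Qs) := ⟨by rwa [Measure.restrict_apply_univ]⟩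
  have hp1 : Integrable (uncurry p) (volume.restrict Qs) :=
    hp32.integrable (by
      rw [← ENNReal.ofReal_one]; exact ENNReal.ofReal_le_ofReal (by norm_num))
  have hintp : ∫ z in Qs, |p z.1 z.2| ≤ V + P := by
    have h32i : Integrable (fun z : ℝ × EuclideanSpace ℝ (Fin 3) => |p z.1 z.2| ^ (3 / 2 : ℝ))
        (volume.restrict Qs) := by
      have := hp32.integrable_norm_rpow (by simp) (by simp)
      rw [ENNReal.toReal_ofReal (by norm_num : (0 : ℝ) ≤ 3 / 2)] at this
      refine this.congr (Eventually.of_forall fun z => ?_)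
      simp [uncurry, Real.norm_eq_abs]
    calc ∫ z in Qs, |p z.1 z.2| ≤ ∫ z in Qs, (1 + |p z.1 z.2| ^ (3 / 2 : ℝ)) := by
          refine integral_mono_ae hp1.norm ((integrable_const 1).add h32i)
            (Eventually.of_forall fun z => ?_)
          exact abs_le_one_add_abs_rpow_three_halves _
      _ = V + ∫ z in Qs, |p z.1 z.2| ^ (3 / 2 : ℝ) := by
          rw [integral_add (integrable_const 1) h32i, integral_const, smul_eq_mul, mul_one,
            measureReal_restrict_apply_univ, hV]
          rfl
      _ ≤ V + P := by
          gcongr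
          have hlin : ∫⁻ z in Qs, ‖p z.1 z.2‖ₑ ^ (3 / 2 : ℝ) =
              ENNReal.ofReal (∫ z in Qs, |p z.1 z.2| ^ (3 / 2 : ℝ)) := by
            rw [ofReal_integral_eq_lintegral_ofReal h32i
              (Eventually.of_forall fun z => Real.rpow_nonneg (abs_nonneg _) _)]
            refine lintegral_congr fun z => ?_
            rw [← ofReal_norm, Real.norm_eq_abs,
              ENNReal.ofReal_rpow_of_nonneg (abs_nonneg _) (by norm_num)]
          have := hp
          rw [hlin] at this
          have h0 : 0 ≤ ∫ z in Qs, |p z.1 z.2| ^ (3 / 2 : ℝ) :=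
            integral_nonneg fun z => Real.rpow_nonneg (abs_nonneg _) _
          exact (ENNReal.ofReal_le_iff_le_toReal ENNReal.coe_ne_top).1 this |>.trans (le_of_eq rfl)
  -- the dominating function
  set F : ℝ × EuclideanSpace ℝ (Fin 3) → ℝ := fun z =>
    Qs.indicator (fun z => (M ^ 2 * (Kt + Kl) + M ^ 2 * |M| * Kg) + 2 * |M| * Kg * |p z.1 z.2|) z
    with hF
  have hFi : Integrable F (volume : Measure (ℝ × EuclideanSpace ℝ (Fin 3))) := by
    rw [hF, integrable_indicator_iff hQmeas]
    exact (integrable_const _).add (hp1.norm.const_mul _)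
  have hF0 : ∀ z, 0 ≤ F z := by
    intro z
    simp only [hF]
    by_cases hz : z ∈ Qs
    · rw [indicator_of_mem hz]; positivity
    · rw [indicator_of_notMem hz]
  have hFint : ∫ z, F z ≤ I := by
    have hbp : Integrable (fun z : ℝ × EuclideanSpace ℝ (Fin 3) => 2 * |M| * Kg * |p z.1 z.2|)
        (volume.restrict Qs) := hp1.norm.const_mul _
    have e : ∫ z, F z = (M ^ 2 * (Kt + Kl) + M ^ 2 * |M| * Kg) * V +
        2 * |M| * Kg * ∫ z in Qs, |p z.1 z.2| := by
      rw [hF, integral_indicator hQmeas, integral_add (integrable_const _) hbp, integral_const,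
        smul_eq_mul, measureReal_restrict_apply_univ, integral_const_mul, hV]
      simp only [Measure.real]
      ring
    rw [e, hI]
    have h2 : 0 ≤ 2 * |M| * Kg := by positivity
    nlinarith [mul_le_mul_of_nonneg_left hintp h2]
  -- the pointwise bound of the local energy integrand below a negative level
  have hbound : ∀ s < (0 : ℝ), ∀ᵐ z ∂(volume : Measure (ℝ × EuclideanSpace ℝ (Fin 3))),
      z ∈ {z : ℝ × EuclideanSpace ℝ (Fin 3) | z.1 < s} → |localEnergyRHS 1 0 u p ζ z| ≤ F z := by
    intro s hs0
    have hbd' : ∀ᵐ z ∂(volume : Measure (ℝ × EuclideanSpace ℝ (Fin 3))), z ∈ Qs → ‖u z.1 z.2‖ ≤ M :=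
      (ae_restrict_iff' hQmeas).1 hbd
    filter_upwards [hbd'] with z hzM hzs
    by_cases hzQ : z ∈ Qs
    · have h := abs_localEnergyRHS_le (u := u) (p := p) (ζ := ζ) (hzM hzQ)
        (by simpa [Real.norm_eq_abs] using hKt z.1 z.2)
        (by simpa [Real.norm_eq_abs] using hKl z.1 z.2)
        (by
          have := hKg z.1 z.2
          simpa [gradient, LinearIsometryEquiv.norm_map] using this)
      refine h.trans (le_of_eq ?_)
      simp only [hF, indicator_of_mem hzQ]
      ring
    · -- outside the cylinder and below `s < 0`: `ζ` and its derivatives vanish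
      have hzsupp : z ∉ tsupport (uncurry ζ) := fun h' =>
        hzQ (hζQ s hs0 ⟨h', (le_of_lt hzs : z.1 ≤ s)⟩)
      have h0 : ζ z.1 z.2 = 0 := image_eq_zero_of_notMem_tsupport (f := uncurry ζ) hzsupp
      have hT : timeDeriv ζ z.1 z.2 = 0 := IsSpaceTimeTestOn.timeDeriv_eq_zero_of_notMem hzsupp
      have hL : Δ (ζ z.1) z.2 = 0 :=
        laplacian_eq_zero_of_notMem_tsupport (notMem_tsupport_slice hzsupp)
      have hgr : gradient (ζ z.1) z.2 = 0 := by
        rw [gradient, IsSpaceTimeTestOn.fderiv_slice_eq_zero_of_notMem hzsupp, map_zero]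
      simp only [hF, indicator_of_notMem hzQ]
      rw [localEnergyRHS_apply, hT, hL, hgr, h0]
      simp
  -- the bound of the right-hand side below a negative level
  have hRHS : ∀ s < (0 : ℝ),
      ENNReal.ofReal (∫ z in {z : ℝ × EuclideanSpace ℝ (Fin 3) | z.1 < s}, localEnergyRHS 1 0 u p ζ z) ≤
        ENNReal.ofReal I := by
    intro s hs0
    refine ENNReal.ofReal_le_ofReal ?_
    have hmeas : MeasurableSet {z : ℝ × EuclideanSpace ℝ (Fin 3) | z.1 < s} :=
      measurableSet_lt measurable_fst measurable_const
    calc ∫ z in {z : ℝ × EuclideanSpace ℝ (Fin 3) | z.1 < s}, localEnergyRHS 1 0 u p ζ z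
        ≤ ∫ z in {z : ℝ × EuclideanSpace ℝ (Fin 3) | z.1 < s}, F z := by
          by_cases hint : IntegrableOn (localEnergyRHS 1 0 u p ζ)
              {z : ℝ × EuclideanSpace ℝ (Fin 3) | z.1 < s} volume
          · refine setIntegral_mono_ae_restrict hint hFi.integrableOn ?_
            rw [Filter.EventuallyLE, ae_restrict_iff' hmeas]
            filter_upwards [hbound s hs0] with z hz hzs
            exact (le_abs_self _).trans (hz hzs)
          · rw [integral_undef hint]
            exact setIntegral_nonneg hmeas fun z _ => hF0 z
      _ ≤ ∫ z, F z := setIntegral_le_integral hFi (Eventually.of_forall hF0)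
      _ ≤ I := hFint
  -- from the sliced inequality: the weighted gradient integral below a good level is bounded
  have hX : ∀ᵐ s ∂(volume : Measure ℝ), s < 0 →
      ∫⁻ z in {z : ℝ × EuclideanSpace ℝ (Fin 3) | z.1 < s},
          ENNReal.ofReal (frobeniusNormSq (G z.1 z.2)) * ENNReal.ofReal (ζ z.1 z.2) ≤
        ENNReal.ofReal I := by
    filter_upwards [hslice] with s hs hs0
    have h := (hs hs0).trans (hRHS s hs0)
    refine le_trans ?_ (le_trans le_add_self h)
    rw [show (2 : ℝ) * 1 = 2 by norm_num, ENNReal.ofReal_ofNat]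
    exact le_mul_of_one_le_left (zero_le (a := _)) one_le_two
  -- good levels arbitrarily close to the top
  have hgood : ∀ n : ℕ, ∃ s ∈ Ioo (-(1 / ((n : ℝ) + 1))) 0,
      ∫⁻ z in {z : ℝ × EuclideanSpace ℝ (Fin 3) | z.1 < s},
          ENNReal.ofReal (frobeniusNormSq (G z.1 z.2)) * ENNReal.ofReal (ζ z.1 z.2) ≤
        ENNReal.ofReal I := by
    intro n
    have hpos : 0 < (1 : ℝ) / ((n : ℝ) + 1) := by positivity
    have hX' : ∀ᵐ s ∂(volume.restrict (Ioo (-(1 / ((n : ℝ) + 1))) 0)),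
        s ∈ Ioo (-(1 / ((n : ℝ) + 1))) 0 ∧ (s < 0 → ∫⁻ z in {z : ℝ × EuclideanSpace ℝ (Fin 3) | z.1 < s},
          ENNReal.ofReal (frobeniusNormSq (G z.1 z.2)) * ENNReal.ofReal (ζ z.1 z.2) ≤
            ENNReal.ofReal I) :=
      (ae_restrict_mem measurableSet_Ioo).and (ae_restrict_of_ae hX)
    haveI : (ae (volume.restrict (Ioo (-(1 / ((n : ℝ) + 1))) (0 : ℝ)))).NeBot := by
      rw [ae_neBot, Ne, Measure.restrict_eq_zero, Real.volume_Ioo, ENNReal.ofReal_eq_zero, not_le]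
      simpa using hpos
    obtain ⟨s, hs, hs'⟩ := hX'.exists
    exact ⟨s, hs, hs' hs.2⟩
  choose s hs hsX using hgood
  -- the exhaustion of the inner cylinder by the regions below the good levels
  set Qr : Set (ℝ × EuclideanSpace ℝ (Fin 3)) :=
    parabolicCylinderCentered r ((-r ^ 2 : ℝ), (0 : EuclideanSpace ℝ (Fin 3))) with hQr
  have hQr_eq : Qr = Ioo (-(2 * r ^ 2)) 0 ×ˢ ball (0 : EuclideanSpace ℝ (Fin 3)) r := by
    show Ioo (-r ^ 2 - r ^ 2) (-r ^ 2 + r ^ 2) ×ˢ ball (0 : EuclideanSpace ℝ (Fin 3)) r = _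
    rw [show -r ^ 2 - r ^ 2 = -(2 * r ^ 2) by ring, show -r ^ 2 + r ^ 2 = (0 : ℝ) by ring]
  set A : ℕ → Set (ℝ × EuclideanSpace ℝ (Fin 3)) := fun n =>
    Qr ∩ {z : ℝ × EuclideanSpace ℝ (Fin 3) | z.1 < -(1 / ((n : ℝ) + 1))} with hA
  have hAmono : Monotone A := by
    intro m n hmn z hz
    refine ⟨hz.1, lt_of_lt_of_le (b := -(1 / ((m : ℝ) + 1))) hz.2 ?_⟩
    have hm1 : (0 : ℝ) < (m : ℝ) + 1 := by positivity
    have : (m : ℝ) + 1 ≤ (n : ℝ) + 1 := by exact_mod_cast Nat.succ_le_succ hmn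
    exact neg_le_neg (one_div_le_one_div_of_le hm1 this)
  have hAU : (⋃ n, A n) = Qr := by
    refine Subset.antisymm (iUnion_subset fun n => inter_subset_left) fun z hz => ?_
    have hz0 : z.1 < 0 := by rw [hQr_eq] at hz; exact hz.1.2
    obtain ⟨n, hn⟩ := exists_nat_one_div_lt (neg_pos.2 hz0)
    exact mem_iUnion.2 ⟨n, hz, by show z.1 < -(1 / ((n : ℝ) + 1)); linarith⟩
  -- on each region the gradient integral is bounded by `I`
  have hAn : ∀ n, ∫⁻ z in A n, ENNReal.ofReal (frobeniusNormSq (G z.1 z.2)) ≤ ENNReal.ofReal I := by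
    intro n
    have hmeasA : MeasurableSet (A n) := by
      rw [hA, hQr_eq]
      exact (measurableSet_Ioo.prod measurableSet_ball).inter
        (measurableSet_lt measurable_fst measurable_const)
    have hsub : A n ⊆ {z : ℝ × EuclideanSpace ℝ (Fin 3) | z.1 < s n} := fun z hz =>
      lt_trans hz.2 (hs n).1
    calc ∫⁻ z in A n, ENNReal.ofReal (frobeniusNormSq (G z.1 z.2))
        = ∫⁻ z in A n, ENNReal.ofReal (frobeniusNormSq (G z.1 z.2)) * ENNReal.ofReal (ζ z.1 z.2) := by
          refine setLIntegral_congr_fun hmeasA fun z hz => ?_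
          have hz' : z ∈ Qr := hz.1
          rw [hQr_eq] at hz'
          have h1 : ζ z.1 z.2 = 1 := hζ1 z ⟨by linarith [hz'.1.1], by linarith [hz'.1.2]⟩ hz'.2
          rw [h1, ENNReal.ofReal_one, mul_one]
      _ ≤ ∫⁻ z in {z : ℝ × EuclideanSpace ℝ (Fin 3) | z.1 < s n},
            ENNReal.ofReal (frobeniusNormSq (G z.1 z.2)) * ENNReal.ofReal (ζ z.1 z.2) :=
          lintegral_mono_set hsub
      _ ≤ ENNReal.ofReal I := hsX n
  -- monotone convergence
  rw [← hAU, setLIntegral_iUnion_of_directed _ hAmono.directed_le]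
  refine iSup_le fun n => (hAn n).trans ?_
  rw [ENNReal.ofReal, ENNReal.coe_le_coe]

end SerrinBootstrap

end Literature.Analysis.FluidPDE

end
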